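import Literature.MathematicalPhysics.QuantumFieldTheory.Balaban1983to89.FlowStepRuns
import Literature.MathematicalPhysics.QuantumFieldTheory.Balaban1983to89.T4BetaStationary
import Literature.MathematicalPhysics.QuantumFieldTheory.Balaban1983to89.Beta.Drift
import Summits.QuantumFields.YangMills.Theorems.BalabanUVNodesN26AtRecord11
import Literature.MathematicalPhysics.QuantumFieldTheory.Balaban1983to89.Node00.Record13
import Literature.MathematicalPhysics.QuantumFieldTheory.Balaban1983to89.Node00.Record13SepCoPH
import Summits.QuantumFields.YangMills.Theses.BalabanUVNodes

/-!
# Sketch — crux idea cards of seat ym-nodeO-idea-5 (obstruction-first) for crux K2⁷ = `stmt-QuantumFields-20543`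
`Summit.QuantumFields.YangMills.Theses.BalabanUVNodes.EndpointGivenBR13SepCoPH`.

First-lemma SIGNATURES only (`def … : Prop`, no `sorry`, nothing asserted).  HONEST FRAMING: the Clay YM mass gap is NOT
proved by anything here; route R4 closes only the conditional finite-𝕋⁴ rung `BalabanLadder.UV`; NODE O ([I] Thm 2) is
UNPROVED in print.  Card A = `log-concave-step-information-sandwich`; Card B = `transposed-d4-backward-uniform-limit`.
-/

noncomputable section

namespace Summit.QuantumFields.YangMills.Cruxes.EndpointGivenBR13SepCoPH.Idea5

open Filter Topology
open Literature.MathematicalPhysics.QuantumFieldTheory.Balaban1983to89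
open FlowStep DagBinding FlowStepRuns T4CouplingMatching T4BetaStationary

/-! ### Card A — information sandwich on the log-concave one-step fibre -/

/-- Row-(D4)-type remainder in HÖLDER-MODULUS form (what the sandwich delivers; weaker than `AtSlope`'s linear slope):
`|β_{k+1}(v) − β⁰_{k+1}| ≤ C·g_k^α` on the boxes `]0,γ]^{k+1}`, EVERY `k`. -/
def RemainderHolder (C α γ : ℝ) (β : HBeta) (β0 : ℕ → ℝ) : Prop :=
  ∀ k, ∀ v ∈ Box γ k, |β k v - β0 k| ≤ C * v (Fin.last k) ^ α

/-- ℓ¹ size of a lattice vector of `ℤ⁴`. -/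
def l1 (x : Fin 4 → ℤ) : ℝ := ∑ i, |(x i : ℝ)|

/-- CONVERSION LEMMA (first checkable statement of the line; elementary): a kernel on `ℤ⁴` that is pointwise `δ`-small
(the PSD sandwich `L ≤ V ≤ U` gives `|K(x)| ≤ sup diag (U − L)`) and exponentially localised (Helffer–Sjöstrand decay) has
second moments `O(δ·log⁶(C/δ)/m⁶)` — so a FORM sandwich of the polarisation does control the (sign-indefinite) second-moment
read-out (1.22). -/
def SecondMomentFromSandwich : Prop :=
  ∃ A : ℝ, 0 < A ∧ ∀ (K : (Fin 4 → ℤ) → ℝ) (δ Cst m : ℝ), 0 < δ → δ ≤ 1 → 0 < m → m ≤ 1 → 1 ≤ Cst →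
    (∀ x, |K x| ≤ δ) → (∀ x, |K x| ≤ Cst * Real.exp (-(m * l1 x))) →
    ∀ μ ν : Fin 4, Summable (fun x => K x * (x μ : ℝ) * (x ν : ℝ)) ∧
      |∑' x, K x * (x μ : ℝ) * (x ν : ℝ)| ≤ A * δ * (1 + Real.log (Cst / δ)) ^ 6 / m ^ 6

/-- JUNCTION A (provable from `FlowStepRuns.endpointExistence_of_eventualLower`): Hölder remainder on the boxes + an
EVENTUAL positive floor of the one-loop numbers (row (D1)'s tail, or Card B's limit sign) + a bound on them + joint
continuity (C) ⟹ `DagBinding.EndpointExistence` for every construction forward-generated by `β`. -/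
def JunctionA : Prop :=
  ∀ (Cn : B12.Construction) (β : HBeta) (β0 : ℕ → ℝ) (C α γ b B : ℝ) (k₀ : ℕ),
    ForwardGenerated Cn β → 0 < γ → 0 < α → 0 ≤ C → 0 < b →
    RemainderHolder C α γ β β0 → (∀ k, k₀ ≤ k → b ≤ β0 k) → (∀ k, |β0 k| ≤ B) →
    BetaContH γ β → EndpointExistence Cn

/-! ### Card B — transposed (D4): backward-uniform limit in the step + zero-amplitude limit per step (Moore–Osgood) -/

/-- (BUL) BACKWARD-UNIFORM LIMIT: read on backward histories (`revHist h k`, `h 0` = the current coupling), the step-`k`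
β-functions converge to node U2's memory functional `betaInf β` UNIFORMLY over all weak-coupling histories — the
RATE-FREE shadow of NE4 `T4CouplingMatching.ScaleShiftRate` (which gives it with rate `c·θ^k/(1−θ)`,
`T4BetaStationary.abs_beta_revHist_sub_betaInf_le`). -/
def BackwardUniformLimit (γ : ℝ) (β : HBeta) : Prop :=
  ∀ ε > 0, ∃ k₀ : ℕ, ∀ k, k₀ ≤ k → ∀ h : ℕ → ℝ, SeqBox γ h → |β k (revHist h k) - betaInf β h| ≤ ε

/-- (ZAU) ZERO-AMPLITUDE LIMIT AT EACH FIXED STEP, uniform in the earlier couplings: `β_{k+1}(v) → β⁰_{k+1}` as the LAST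
coupling `g_k → 0⁺` ((2.13) p. 268: the remainder carries `g_k^{1/2}`; history-independence of the limit is part of the claim). -/
def ZeroAmplitudeUniform (γ : ℝ) (β : HBeta) (β0 : ℕ → ℝ) : Prop :=
  ∀ k, ∀ ε > 0, ∃ δ > 0, ∀ v ∈ Box γ k, v (Fin.last k) ≤ δ → |β k v - β0 k| ≤ ε

/-- MOORE–OSGOOD, existence half: (BUL) + (ZAU) ⟹ the one-loop numbers CONVERGE (no rate, no transfer, no CAP). -/
def MooreOsgoodLimit : Prop :=
  ∀ (γ : ℝ) (β : HBeta) (β0 : ℕ → ℝ), 0 < γ → BackwardUniformLimit γ β → ZeroAmplitudeUniform γ β β0 →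
    ∃ b : ℝ, Tendsto β0 atTop (𝓝 b)

/-- MOORE–OSGOOD, tail half: … and if that limit is positive, `β` has an EVENTUAL positive floor on a smaller box —
exactly the `htail` of `FlowStepRuns.endpointExistence_of_eventualLower` / `T4CouplingMatching.EventualLowerH`. -/
def MooreOsgoodTail : Prop :=
  ∀ (γ : ℝ) (β : HBeta) (β0 : ℕ → ℝ) (b : ℝ), 0 < γ → BackwardUniformLimit γ β → ZeroAmplitudeUniform γ β β0 →
    Tendsto β0 atTop (𝓝 b) → 0 < b → ∃ γ₀ : ℝ, 0 < γ₀ ∧ γ₀ ≤ γ ∧ ∃ k₀ : ℕ, EventualLowerH (b / 2) γ₀ k₀ β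

/-- JUNCTION B (provable from `endpointExistence_of_eventualLower`): the Moore–Osgood tail + the printed two-sided bound
+ (C) ⟹ the endpoint. -/
def JunctionB : Prop :=
  ∀ (Cn : B12.Construction) (β : HBeta) (γ₀ b β' : ℝ) (k₀ : ℕ), ForwardGenerated Cn β → 0 < γ₀ → 0 < b → 0 ≤ β' →
    EventualLowerH b γ₀ k₀ β → BetaLowerH (-β') γ₀ β → BetaUpperH β' γ₀ β → BetaContH γ₀ β → EndpointExistence Cn

/-! ### Card A at the record — the line's two β-side stubs in OBJECT-FREE currency (no `ChainTFac190H` inhabitant) -/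

section Record
open scoped Matrix.Norms.L2Operator
open Node00
open Beta.OneStepKernelFamily (TbalOf)
open Beta.OneStepResolventKernel (JetData)

/-- (AF-1) AT THE STAGE-13 RECORD with QUADRATIC slope — what the Witten-Laplacian expansion on the convex fibre is to deliver
for the record's one-loop split (`S.β1 = β − β⁰` on the box): `|β¹_{k+1}(g_0,…,g_k)| ≤ C·g_k²` on `]0,γ₀]`-histories, EVERY `k`.
This is the `hAF1` input of `Beta.Drift.endpointExistence_of_drift` (with `Cr = C·γ₀`, so `Cr·γ₀ ≤ b` for `γ₀` small). -/
def AF1AtRecord13 : Prop :=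
  ∀ (F : T4Continuum.T4Family) (θ : Node00.Stage13HParams F 2) (_hP : θ.Provisos₁₃SepCoPH F 2), θ.Admissible F 2 →
    letI := θ.instVβ₁; letI := θ.instVβ₂; letI := θ.instιβ
    ∃ C γ₀ : ℝ, 0 ≤ C ∧ 0 < γ₀ ∧ γ₀ ≤ θ.γ ∧ ∀ k (p : Fin (k + 1) → ℝ), p ∈ B12Beta.HistBox γ₀ k →
      |(oneLoopSplit_betaOfMerged
          (betaMerged F (mergedTermFamilyMatT F 2 (TcanOfRecord F 2) (chiFixed29 F 2 θ.ν θ.ε₂₉) θ.εbg) θ.ρ8 θ.bV)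
          (beta0OfMerged (betaMerged F (mergedTermFamilyMatT F 2 (TcanOfRecord F 2) (chiFixed29 F 2 θ.ν θ.ε₂₉) θ.εbg) θ.ρ8 θ.bV) θ.v₀)
          θ.γ).β1 k p| ≤ C * p (Fin.last k)

/-- (C) ∧ (U) AT THE RECORD on a small box — the same engine's by-products (history-derivatives of `β` are fibre correlations;
`|β| ≤ |β⁰| + C·γ₀²`). -/
def ContUpAtRecord13 : Prop :=
  ∀ (F : T4Continuum.T4Family) (θ : Node00.Stage13HParams F 2) (_hP : θ.Provisos₁₃SepCoPH F 2), θ.Admissible F 2 →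
    letI := θ.instVβ₁; letI := θ.instVβ₂; letI := θ.instιβ
    ∃ γ₀ β' : ℝ, 0 < γ₀ ∧ γ₀ ≤ θ.γ ∧ 0 ≤ β' ∧
      BetaContH γ₀ (betaOfMerged (betaMerged F (mergedTermFamilyMatT F 2 (TcanOfRecord F 2) (chiFixed29 F 2 θ.ν θ.ε₂₉) θ.εbg) θ.ρ8 θ.bV)
        (beta0OfMerged (betaMerged F (mergedTermFamilyMatT F 2 (TcanOfRecord F 2) (chiFixed29 F 2 θ.ν θ.ε₂₉) θ.εbg) θ.ρ8 θ.bV) θ.v₀) θ.γ) ∧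
      BetaUpperH β' γ₀ (betaOfMerged (betaMerged F (mergedTermFamilyMatT F 2 (TcanOfRecord F 2) (chiFixed29 F 2 θ.ν θ.ε₂₉) θ.εbg) θ.ρ8 θ.bV)
        (beta0OfMerged (betaMerged F (mergedTermFamilyMatT F 2 (TcanOfRecord F 2) (chiFixed29 F 2 θ.ν θ.ε₂₉) θ.εbg) θ.ρ8 θ.bV) θ.v₀) θ.γ)

/-- (C) ALONE at the Stage-13 record (what `D1Residue.endpointExistence_of_residue` consumes besides `RemainderConst`):
continuity of the record's definitional `betaOfMerged` on some box `]0, γ₀]`, `0 < γ₀ ≤ θ.γ`. -/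
def ContAtRecord13 : Prop :=
  ∀ (F : T4Continuum.T4Family) (θ : Node00.Stage13HParams F 2) (_hP : θ.Provisos₁₃SepCoPH F 2), θ.Admissible F 2 →
    letI := θ.instVβ₁; letI := θ.instVβ₂; letI := θ.instιβ
    ∃ γ₀ : ℝ, 0 < γ₀ ∧ γ₀ ≤ θ.γ ∧
      BetaContH γ₀
        (betaOfMerged (betaMerged F (mergedTermFamilyMatT F 2 (TcanOfRecord F 2) (chiFixed29 F 2 θ.ν θ.ε₂₉) θ.εbg) θ.ρ8 θ.bV)
          (beta0OfMerged (betaMerged F (mergedTermFamilyMatT F 2 (TcanOfRecord F 2) (chiFixed29 F 2 θ.ν θ.ε₂₉) θ.εbg) θ.ρ8 θ.bV) θ.v₀) θ.γ)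

/-- The elementary junction the line's composition uses (all tree theorems; recorded as a Prop so the card's claim is checkable by `exact?`-free means later):
AF-1 with constant `C` on `]0,γ₀]` + a (D1) residue datum with POSITIVE slope `s` ⟹ `RemainderConst` at slope `s` on the shrunk box `]0, min γ₀ (s/(C+1))]`
(`Beta.RemainderChain.remainderConst_of_af1` + `HistBox` monotonicity), whence `D1Residue.endpointExistence_of_residue`. -/
def JunctionAF1 : Prop :=
  ∀ (β : HBeta) (S : B12Beta.OneLoopSplit β) (C γ₀ s : ℝ), 0 ≤ C → 0 < γ₀ → 0 < s →
    (∀ k (p : Fin (k + 1) → ℝ), p ∈ B12Beta.HistBox γ₀ k → |S.β1 k p| ≤ C * p (Fin.last k)) →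
    ∃ γ₁ : ℝ, 0 < γ₁ ∧ γ₁ ≤ γ₀ ∧ Beta.RemainderChain.RemainderConst S γ₁ s

/-- `JunctionAF1` PROVED (elementary; the only tree input is `remainderConst_of_af1`). -/
theorem junctionAF1 : JunctionAF1 := by
  intro β S C γ₀ s hC hγ₀ hs hAF1
  refine ⟨min γ₀ (s / (C + 1)), lt_min hγ₀ (div_pos hs (by linarith)), min_le_left _ _, ?_⟩
  have hsub : ∀ k, B12Beta.HistBox (min γ₀ (s / (C + 1))) k ⊆ B12Beta.HistBox γ₀ k :=
    fun k p hp i => ⟨(hp i).1, (hp i).2.trans (min_le_left _ _)⟩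
  have h1 : Beta.RemainderChain.RemainderConst S (min γ₀ (s / (C + 1))) (C * min γ₀ (s / (C + 1))) :=
    Beta.RemainderChain.remainderConst_of_af1 S hC (fun k p hp => hAF1 k p (hsub k hp))
  intro k p hp
  refine (h1 k p hp).trans ?_
  have hC1 : 0 < C + 1 := by linarith
  calc C * min γ₀ (s / (C + 1)) ≤ C * (s / (C + 1)) :=
        mul_le_mul_of_nonneg_left (min_le_right _ _) hC
    _ ≤ (C + 1) * (s / (C + 1)) := mul_le_mul_of_nonneg_right (by linarith) (div_nonneg hs.le hC1.le)
    _ = s := by field_simp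

end Record

/-- Where both cards land: the crux BY NAME is reached from `EndpointExistence` of the datum's `.C.toB12` (the
registered composition `K2Skeleton13SepCoPH.EndpointGivenBR13SepCoPH_of` already has this shape). -/
def LandsOnCrux : Prop :=
  (∀ (F : T4Continuum.T4Family) (θ : Node00.Stage13HParams F 2) (h : θ.Provisos₁₃SepCoPH F 2), θ.Admissible F 2 →
      EndpointExistence (Node00.datumOfRecord₁₃SepCoPH F 2 θ h).C.toB12) →
    Summit.QuantumFields.YangMills.Theses.BalabanUVNodes.EndpointGivenBR13SepCoPH

end Summit.QuantumFields.YangMills.Cruxes.EndpointGivenBR13SepCoPH.Idea5
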